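import Literature.MathematicalPhysics.QuantumFieldTheory.Balaban1983to89.B3VertexBridge

/-!
# `Balaban1983to89.B3Cor23Concrete` — T. Bałaban, *(Higgs)₂,₃ quantum fields in a finite volume. III. Renormalization*,
Commun. Math. Phys. **88** (1983) 411–445 [Balaban1983Higgs3]: **Corollary 2.3** (p. 429) and the estimate **(2.17)** decided
on the CONCRETE family of graphs built from the vertex catalogue (1.6)–(1.15)

statement-level skeleton of published theorems with citation tags; proofs where landed; nothing here is a claim about the Yang–Mills mass gap

PDF held: `paper:balaban1983-higgs-2-3-quantum-fields-finite-volume` (journal page = PDF page + 410).  Renders read as images for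
every quotation below: `run/shared/lean/pub/pub-balaban/b2b-balaban-ref1/pages/1983-cmp88-higgs23-III/1983-cmp88-higgs23-III-p003,
p004, p005, p007, p008, p012, p013, p018, p019, p021, p022-x4.png` (journal pp. 413, 414, 415, 417, 418, 422, 423, 428, 429, 431, 432).

CITATION HEADER (lean-in-tree rule).  Part of the lit-balaban TYPED SKELETON (HOME `run/shared/lean/pub/lit-balaban/`), Phase 2,
seat p18 (PHASE2-TARGETS §G.3), SKELETON rows **B3.Cor2.3** (decl of record `B3Sect2Statements.Cor23`, kind «model-instance») and
**B3.Eq2.17** (`B3Sect2Statements.Ineq217`, the estimate the printed proof of Cor. 2.3 invokes: *"from which it follows that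
the graphs with more than four external legs have positive degree in d = 3"*, p. 429).  Unit `lit-balaban-p18`.

THE MODEL INSTANCE (`Graph`, `family`).  p. 415 [PDF 5], verbatim: *"Now a graph for us is a collection of internal lines,
external legs, and vertices connected in the usual sense. There is at least one internal line, and every internal line has a
vertex at each endpoint. The construction of graphs is otherwise arbitrary."*  A graph of the model is: finitely many vertices,
each a vertex of the catalogue (1.6)–(1.15) (`B3Prop1.VertexKind`) satisfying the printed side conditions for the expansion
order n̄ (`VertexKind.Admissible n̄`; n̄ > 12 is the paper's standing choice, p. 418 l. 1); the legs of a vertex are its φ′-legs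
and its A′-legs (`B3VertexBridge.toCounts`; the legs of the external field Ã are *external fields* of dimension 0, p. 422, and
are not legs of the graph); the internal lines are recorded by the map «the other endpoint of the line through this leg» — a
fixed-point-free symmetric partial pairing of legs joining φ′-legs to φ′-legs and A′-legs to A′-legs (p. 414: *"All the A′-legs
are contracted, i.e. they are divided into pairs and each pair is replaced by the corresponding propagator. Some φ′-legs are
replaced by external scalar fields and the remaining are again divided into pairs"*), with at least one line; the covariant
differentiation D^η_B̃ of (1.8)/(1.9) acts on its φ′(b)-leg (the first scalar leg), so it *"acts on an internal line"* (2.1) iff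
that leg is internal.  Mass renormalization vertices are taken in the ATTACHED form of p. 423 [PDF 13], verbatim: *"Thus the
degree of G is the same as the degree of a graph G′ obtained from G by attaching the corresponding graphs to the mass
renormalization vertices"* — so every vertex (1.7) present carries one of the finite counterterms δm²_fin, δm²_{K,k} (*"We will
say also that the degrees of these counterterms are equal to 0"*, p. 423) and D(G) is (2.2) (`B3Sect2Statements.graphDegree`
with all counterterm degrees 0).  Connectedness (p. 423 "degree of a connected graph") is NOT imposed: every positive result
below holds for all graphs of the model, and the refuting graphs are connected.  The dimension `d` is a parameter of the degree.

WHAT THIS MODULE CONTAINS (all sorry-free; no `Prop` fact is introduced).  The carrier `Graph n̄` with its degree data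
((2.1) `Graph.vertexDeg`, (2.2) `Graph.deg`, the number of external legs `Graph.numExtLegs` with `numExtLegs_eq_card`), the
family `family d n̄ : B3Sect2Statements.GraphFamily`, the "other endpoint" lemmas the case analysis of pp. 428–429 uses
(`Graph.other_scalar`, `Graph.other_vector`), and the per-vertex evaluations of (2.1) on the catalogue in d = 3 (`Facts.*`: every admissible
vertex has D_G(v) ≥ 1/2, ≥ 1 unless exactly one A′-leg is internal; vertices (1.13)–(1.15) have D_G(v) ≥ 5/2, ≥ 3 = d with an
internal A′-leg, > d with two; R-vertices have D_G(v) ≥ n̄ + 1) and, for every d ≥ 2, the leg bookkeeping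
`Facts.degree_add_ext_le_degreeIn` (each external leg raises (2.1) by (d−2)/2).  The sibling module `…B3Cor23ConcreteProof`
proves on this carrier: (2.17) for 2 ≤ d ≤ 4, the four printed implications of Cor. 2.3 in d = 3 (the third one with «≥ 2
external legs»), Cor. 2.3 verbatim on the graphs with ≥ 2 external legs, and its failure as printed (the (1.7)-tadpole).
-/

namespace Literature.MathematicalPhysics.QuantumFieldTheory.Balaban1983to89.B3Cor23Concrete

open Finset B3Prop1 B3Sect2Statements B3VertexBridge

/-! ## The concrete graphs of the expansion -/

/-- The legs of a family of catalogue vertices: a leg is a vertex together with one of its φ′-legs (`inl`) or one of its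
A′-legs (`inr`) (p. 415: *"an external scalar field, or a leg in a vertex … an external vector field, or a leg in a vertex"*).
[cite: Balaban1983Higgs3, (1.17) p.415] -/
abbrev Leg {nV : ℕ} (kind : Fin nV → VertexKind) : Type :=
  Σ i : Fin nV, (Fin (kind i).scalarLegs ⊕ Fin (kind i).vectorLegs)

/-- A graph of the perturbation expansion, p. 415 [PDF 5], verbatim: *"Now a graph for us is a collection of internal lines,
external legs, and vertices connected in the usual sense. There is at least one internal line, and every internal line has a
vertex at each endpoint. The construction of graphs is otherwise arbitrary."* — vertices from the catalogue (1.6)–(1.15) with the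
printed side conditions for the order n̄; internal lines as the pairing «other endpoint» of legs (scalar with scalar, vector with
vector, p. 414); mass renormalization vertices in the attached form of p. 423 (module docstring).
[cite: Balaban1983Higgs3, p.415] -/
structure Graph (nbar : ℕ) where
  /-- number of vertices -/
  nV : ℕ
  /-- the vertices, from the catalogue (1.6)–(1.15) -/
  kind : Fin nV → VertexKind
  /-- the printed side conditions "n, n′ ≤ n̄, n + n′ ≥ 1", … -/
  adm : ∀ i, (kind i).Admissible nbar
  /-- the internal lines: the other endpoint of the line through a leg (`none` = the leg is external) -/
  other : Leg kind → Option (Leg kind)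
  /-- a line has two distinct endpoints -/
  other_ne : ∀ x y, other x = some y → y ≠ x
  /-- "the other endpoint" is symmetric -/
  other_symm : ∀ x y, other x = some y → other y = some x
  /-- scalar lines join φ′-legs, vector lines join A′-legs -/
  other_isLeft : ∀ x y, other x = some y → x.2.isLeft = y.2.isLeft
  /-- "There is at least one internal line" -/
  exists_line : ∃ x, (other x).isSome

namespace Graph

variable {nbar : ℕ} (G : Graph nbar)

/-- the number of φ′-legs of the vertex `i` lying on internal lines of G ((2.1) p. 422). [cite: Balaban1983Higgs3, (2.1) p.422] -/
def intScalar (i : Fin G.nV) : ℕ := (univ.filter fun j : Fin (G.kind i).scalarLegs => (G.other ⟨i, .inl j⟩).isSome).card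

/-- the number of A′-legs of the vertex `i` lying on internal lines of G ((2.1) p. 422). [cite: Balaban1983Higgs3, (2.1) p.422] -/
def intVector (i : Fin G.nV) : ℕ := (univ.filter fun j : Fin (G.kind i).vectorLegs => (G.other ⟨i, .inr j⟩).isSome).card

/-- the number of differentiations of the vertex `i` acting on internal lines of G ((2.1) p. 422): the differentiation D^η_B̃
of (1.8)/(1.9) acts on the leg φ′(b), the first scalar leg. [cite: Balaban1983Higgs3, (2.1) p.422] -/
def intDiffs (i : Fin G.nV) : ℕ :=
  if h : 0 < (G.kind i).scalarLegs then (if (G.other ⟨i, .inl ⟨0, h⟩⟩).isSome then (G.kind i).diffCount else 0) else 0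

/-- the number of legs (φ′ or A′) of the vertex `i` NOT lying on internal lines, i.e. its external legs.
[cite: Balaban1983Higgs3, (2.17) p.429] -/
def extLegs (i : Fin G.nV) : ℕ := ((G.kind i).scalarLegs - G.intScalar i) + ((G.kind i).vectorLegs - G.intVector i)

/-- "(a number of external legs)" of (2.17) / Cor. 2.3: the legs of the vertices of G not lying on internal lines, counted
vertex by vertex (= the number of legs `x` with `other x = none`, `numExtLegs_eq_card`). [cite: Balaban1983Higgs3, (2.17) p.429] -/
def numExtLegs : ℕ := ∑ i, G.extLegs i

/-- kernel: internal φ′-legs of a vertex are among its φ′-legs. [cite: Balaban1983Higgs3, (2.1) p.422] -/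
theorem intScalar_le (i : Fin G.nV) : G.intScalar i ≤ (G.kind i).scalarLegs :=
  (card_filter_le _ _).trans (by simp)

/-- kernel: internal A′-legs of a vertex are among its A′-legs. [cite: Balaban1983Higgs3, (2.1) p.422] -/
theorem intVector_le (i : Fin G.nV) : G.intVector i ≤ (G.kind i).vectorLegs :=
  (card_filter_le _ _).trans (by simp)

/-- kernel: differentiations acting on internal lines are among the differentiations of the vertex. [cite: Balaban1983Higgs3, (2.1) p.422] -/
theorem intDiffs_le (i : Fin G.nV) : G.intDiffs i ≤ (G.kind i).diffCount := by
  unfold intDiffs; split_ifs <;> simp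

/-- kernel: the vertex-by-vertex count `numExtLegs` is the number of legs of G not lying on internal lines.
[cite: Balaban1983Higgs3, (2.17) p.429] -/
theorem numExtLegs_eq_card : G.numExtLegs = (univ.filter fun x : Leg G.kind => G.other x = none).card := by
  rw [card_filter, Fintype.sum_sigma]
  refine sum_congr rfl fun i _ => ?_
  rw [Fintype.sum_sum_type, ← card_filter, ← card_filter]
  have hs := card_filter_add_card_filter_not (s := (univ : Finset (Fin (G.kind i).scalarLegs)))
    (fun j => ((G.other ⟨i, .inl j⟩).isSome : Prop))
  have hv := card_filter_add_card_filter_not (s := (univ : Finset (Fin (G.kind i).vectorLegs)))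
    (fun j => ((G.other ⟨i, .inr j⟩).isSome : Prop))
  simp only [Option.not_isSome_iff_eq_none, card_univ, Fintype.card_fin] at hs hv
  unfold extLegs intScalar intVector
  omega

/-- The incidence data (2.1) of the vertex `i` in G. [cite: Balaban1983Higgs3, (2.1) p.422] -/
def incidence (d : ℕ) (i : Fin G.nV) : Incidence (toCounts d (G.kind i)) :=
  ⟨G.intScalar i, G.intVector i, G.intDiffs i, G.intScalar_le i, G.intVector_le i, G.intDiffs_le i⟩

/-- D_G(v) of (2.1) for the vertex `i` of G in dimension `d`. [cite: Balaban1983Higgs3, (2.1) p.422] -/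
def vertexDeg (d : ℕ) (i : Fin G.nV) : ℚ := degreeIn d (toCounts d (G.kind i)) (G.incidence d i)

/-- The vertices of G with their incidence data and counterterm degree 0 (attached form, p. 423), as consumed by (2.2)–(2.3)
`B3Sect2Statements.graphDegree`. [cite: Balaban1983Higgs3, (2.3) p.423] -/
def vertexData (d : ℕ) (i : Fin G.nV) : GraphVertex := ⟨toCounts d (G.kind i), G.incidence d i, 0⟩

/-- D(G) of (2.2)–(2.3) in dimension `d`. [cite: Balaban1983Higgs3, (2.2) p.423] -/
def deg (d : ℕ) : ℚ := graphDegree d univ (G.vertexData d)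

/-- "G has a vertex of the form (1.13)–(1.15)". [cite: Balaban1983Higgs3, Cor. 2.3 p.429] -/
def HasVertex1315 : Prop := ∃ i, (G.kind i).isOfForm1315 = true

/-- "G has an R-vertex" ((1.9), (1.11), (1.15)). [cite: Balaban1983Higgs3, Cor. 2.3 p.429] -/
def HasRVertex : Prop := ∃ i, (G.kind i).isRVertex = true

/-- "G has a vertex (1.7) with finite counterterms" — in the attached form every vertex (1.7) present carries δm²_fin or
δm²_{K,k} (p. 423). [cite: Balaban1983Higgs3, Cor. 2.3 p.429] -/
def HasFiniteCounterterm : Prop := ∃ i, G.kind i = .v17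

/-- kernel: (2.2) for the model — D(G) = Σ_v D_G(v) − d. [cite: Balaban1983Higgs3, (2.2) p.423] -/
theorem deg_eq (d : ℕ) : G.deg d = (∑ i, G.vertexDeg d i) - d :=
  graphDegree_eq_22 d univ (G.vertexData d) (fun _ _ => rfl)

/-- kernel: (2.1) for the model, unfolded. [cite: Balaban1983Higgs3, (2.1) p.422] -/
theorem vertexDeg_eq (d : ℕ) (i : Fin G.nV) :
    G.vertexDeg d i = ((G.kind i).etaCount d : ℚ) + ((G.intScalar i + G.intVector i : ℕ) : ℚ) * ((2 - (d : ℚ)) / 2)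
      - (G.intDiffs i : ℚ) + (if (G.kind i).isAveragingVertex then (G.intVector i : ℚ) else 0) := rfl

/-! ### The other endpoint of a line -/

/-- kernel: the other endpoint of the line through an internal φ′-leg is an internal φ′-leg of some vertex (*"every internal line
has a vertex at each endpoint"*, p. 415). [cite: Balaban1983Higgs3, p.415] -/
theorem other_scalar {i : Fin G.nV} {j : Fin (G.kind i).scalarLegs} {y : Leg G.kind} (h : G.other ⟨i, .inl j⟩ = some y) :
    ∃ i' : Fin G.nV, ∃ j' : Fin (G.kind i').scalarLegs, y = ⟨i', .inl j'⟩ ∧ G.other ⟨i', .inl j'⟩ = some ⟨i, .inl j⟩ := by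
  obtain ⟨i', y2⟩ := y
  have hl := G.other_isLeft _ _ h
  cases y2 with
  | inl j' => exact ⟨i', j', rfl, G.other_symm _ _ h⟩
  | inr j' => simp at hl

/-- kernel: the other endpoint of the line through an internal A′-leg is an internal A′-leg of some vertex (p. 415).
[cite: Balaban1983Higgs3, p.415] -/
theorem other_vector {i : Fin G.nV} {j : Fin (G.kind i).vectorLegs} {y : Leg G.kind} (h : G.other ⟨i, .inr j⟩ = some y) :
    ∃ i' : Fin G.nV, ∃ j' : Fin (G.kind i').vectorLegs, y = ⟨i', .inr j'⟩ ∧ G.other ⟨i', .inr j'⟩ = some ⟨i, .inr j⟩ := by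
  obtain ⟨i', y2⟩ := y
  have hl := G.other_isLeft _ _ h
  cases y2 with
  | inl j' => simp at hl
  | inr j' => exact ⟨i', j', rfl, G.other_symm _ _ h⟩

/-- kernel: a vertex with an internal φ′-leg has at least one internal φ′-leg. [cite: Balaban1983Higgs3, (2.1) p.422] -/
theorem one_le_intScalar {i : Fin G.nV} (j : Fin (G.kind i).scalarLegs) (h : (G.other ⟨i, .inl j⟩).isSome) :
    1 ≤ G.intScalar i :=
  card_pos.mpr ⟨j, by simpa using h⟩

/-- kernel: a vertex with an internal A′-leg has at least one internal A′-leg. [cite: Balaban1983Higgs3, (2.1) p.422] -/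
theorem one_le_intVector {i : Fin G.nV} (j : Fin (G.kind i).vectorLegs) (h : (G.other ⟨i, .inr j⟩).isSome) :
    1 ≤ G.intVector i :=
  card_pos.mpr ⟨j, by simpa using h⟩

/-- kernel: a vertex with two distinct internal A′-legs has at least two (*"both endpoints of l belong to v"*, p. 428).
[cite: Balaban1983Higgs3, p.428] -/
theorem two_le_intVector {i : Fin G.nV} (j j' : Fin (G.kind i).vectorLegs) (hne : j ≠ j')
    (h : (G.other ⟨i, .inr j⟩).isSome) (h' : (G.other ⟨i, .inr j'⟩).isSome) : 2 ≤ G.intVector i :=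
  one_lt_card_iff.mpr ⟨j, j', by simpa using h, by simpa using h', hne⟩

/-- kernel: a positive count of internal φ′-legs exhibits one. [cite: Balaban1983Higgs3, (2.1) p.422] -/
theorem exists_of_one_le_intScalar {i : Fin G.nV} (h : 1 ≤ G.intScalar i) :
    ∃ j : Fin (G.kind i).scalarLegs, (G.other ⟨i, .inl j⟩).isSome := by
  obtain ⟨j, hj⟩ := card_pos.mp h
  exact ⟨j, by simpa using hj⟩

/-- kernel: a positive count of internal A′-legs exhibits one. [cite: Balaban1983Higgs3, (2.1) p.422] -/
theorem exists_of_one_le_intVector {i : Fin G.nV} (h : 1 ≤ G.intVector i) :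
    ∃ j : Fin (G.kind i).vectorLegs, (G.other ⟨i, .inr j⟩).isSome := by
  obtain ⟨j, hj⟩ := card_pos.mp h
  exact ⟨j, by simpa using hj⟩

end Graph

/-- The concrete family of graphs of the expansion in dimension `d` for the order n̄, as a `B3Sect2Statements.GraphFamily`
(numbers of vertices and external legs, the degree (2.2), the three printed vertex predicates).
[cite: Balaban1983Higgs3, Cor. 2.3 p.429] -/
def family (d nbar : ℕ) : GraphFamily where
  Graph := Graph nbar
  numVertices G := G.nV
  numExtLegs G := G.numExtLegs
  degree G := G.deg d
  hasVertex1315 G := G.HasVertex1315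
  hasRVertex G := G.HasRVertex
  hasFiniteCounterterm G := G.HasFiniteCounterterm

/-! ## Per-vertex degree facts ((2.1) evaluated on the catalogue) -/

namespace Facts

/-- kernel: the vertices (1.14)–(1.15) are of the form (1.13)–(1.15). [cite: Balaban1983Higgs3, Cor. 2.3 p.429] -/
theorem isOfForm1315_of_isAveraging (v : VertexKind) (h : v.isAveragingVertex = true) : v.isOfForm1315 = true := by
  cases v <;> simp_all [VertexKind.isAveragingVertex, VertexKind.isOfForm1315]

/-- kernel: the vertices (1.13)–(1.15) have exactly one φ′-leg (pp. 413–414). [cite: Balaban1983Higgs3, (1.13)–(1.15) pp.413–414] -/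
theorem scalarLegs_of_isOfForm1315 (v : VertexKind) (h : v.isOfForm1315 = true) : v.scalarLegs = 1 := by
  cases v <;> simp_all [VertexKind.isOfForm1315, VertexKind.scalarLegs]

/-- Every external leg raises the degree (2.1) of a vertex NOT of the form (1.14)–(1.15) by (d−2)/2 ≥ 0 (legs have dimension
−(d−2)/2, external fields dimension 0, p. 422) and external differentiations raise it by 1: D(v) + ext(v)·(d−2)/2 ≤ D_G(v).
[cite: Balaban1983Higgs3, (2.1) p.422] -/
theorem degree_add_ext_le_degreeIn (d : ℕ) (c : VertexCounts) (hc : c.averaging = false) (inc : Incidence c) :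
    degree d c + (((c.scalarLegs - inc.intScalar) + (c.vectorLegs - inc.intVector) : ℕ) : ℚ) * (((d : ℚ) - 2) / 2)
      ≤ degreeIn d c inc := by
  have h1 : ((c.scalarLegs - inc.intScalar : ℕ) : ℚ) = c.scalarLegs - inc.intScalar := Nat.cast_sub inc.hScalar
  have h2 : ((c.vectorLegs - inc.intVector : ℕ) : ℚ) = c.vectorLegs - inc.intVector := Nat.cast_sub inc.hVector
  have h3 : (inc.intDiffs : ℚ) ≤ c.diffs := by exact_mod_cast inc.hDiffs
  simp only [degree, degreeIn, Incidence.full, hc, Bool.false_eq_true, if_false, add_zero]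
  push_cast [h1, h2]
  nlinarith [h3]

/-- d = 3: every admissible vertex of the catalogue has D_G(v) ≥ 1/2 in every graph, and D_G(v) ≥ 1 unless exactly one of its
A′-legs is internal (the case D_G(v) = 1/2 is the vertex (1.8) with n = 1, n′ = 0, all elements internal — the "analyzing more
carefully" of p. 429 l. 3). [cite: Balaban1983Higgs3, p.429] -/
theorem half_le_degreeIn {nbar : ℕ} (v : VertexKind) (hv : v.Admissible nbar) (inc : Incidence (toCounts 3 v)) :
    1 / 2 ≤ degreeIn 3 (toCounts 3 v) inc ∧ (inc.intVector ≠ 1 → 1 ≤ degreeIn 3 (toCounts 3 v) inc) := by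
  obtain ⟨s', a', δ', hs, ha, hδ⟩ := inc
  have hs' : (s' : ℚ) ≤ _ := Nat.cast_le.mpr hs
  have ha' : (a' : ℚ) ≤ _ := Nat.cast_le.mpr ha
  have hδ' : (δ' : ℚ) ≤ _ := Nat.cast_le.mpr hδ
  have ha0 : (0 : ℚ) ≤ a' := Nat.cast_nonneg _
  have hs0 : (0 : ℚ) ≤ s' := Nat.cast_nonneg _
  have hδ0 : (0 : ℚ) ≤ δ' := Nat.cast_nonneg _
  cases v <;>
    simp only [VertexKind.Admissible, toCounts, VertexKind.etaCount, VertexKind.scalarLegs, VertexKind.vectorLegs,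
      VertexKind.diffCount, VertexKind.isAveragingVertex, degreeIn, Nat.cast_ofNat, Nat.cast_zero, Nat.cast_one,
      Bool.false_eq_true, if_false, if_true] at hv hs' ha' hδ' ha ⊢ <;>
    push_cast at hs' ha' hδ' ⊢
  case v16 => constructor <;> intros <;> linarith
  case v17 => constructor <;> intros <;> linarith
  case v18 n n' =>
    obtain ⟨-, -, h1⟩ := hv
    have h1' : (1 : ℚ) ≤ n + n' := by exact_mod_cast h1
    refine ⟨by linarith, fun hne => ?_⟩
    rcases Nat.eq_zero_or_pos a' with h0 | hpos
    · subst h0; simp; linarith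
    · have h2 : (2 : ℚ) ≤ a' := by exact_mod_cast (show 2 ≤ a' by omega)
      linarith
  case v19 n nb =>
    have : (0 : ℚ) ≤ nb := Nat.cast_nonneg _
    have : (0 : ℚ) ≤ n := Nat.cast_nonneg _
    constructor <;> intros <;> linarith
  case v110 n n' =>
    obtain ⟨-, -, -, h2⟩ := hv
    have h2' : (2 : ℚ) ≤ n + n' := by exact_mod_cast h2
    constructor <;> intros <;> linarith
  case v111 n nb =>
    have : (0 : ℚ) ≤ nb := Nat.cast_nonneg _
    have : (0 : ℚ) ≤ n := Nat.cast_nonneg _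
    constructor <;> intros <;> linarith
  case v113 => constructor <;> intros <;> linarith
  case v114 n n' => constructor <;> intros <;> linarith
  case v115 n nb => constructor <;> intros <;> linarith

/-- d = 3, vertices of the form (1.13)–(1.15) (p. 428 l. −4 – p. 429 l. 1): D_G(v) ≥ 5/2 always (= d + (−d+2)/2 when only the
φ′-leg is internal); ≥ 3 = d if an A′-leg is internal (*"we always have D_G(v) − d ≥ 0"*); ≥ 7/2 > d if two are (*"If both
endpoints of l belong to v, then we have D_G(v) − d > 0"*); = 3 if no element is internal. [cite: Balaban1983Higgs3, p.428] -/
theorem degreeIn_1315 (v : VertexKind) (h1315 : v.isOfForm1315 = true) (inc : Incidence (toCounts 3 v)) :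
    5 / 2 ≤ degreeIn 3 (toCounts 3 v) inc ∧ (1 ≤ inc.intVector → 3 ≤ degreeIn 3 (toCounts 3 v) inc) ∧
      (2 ≤ inc.intVector → 7 / 2 ≤ degreeIn 3 (toCounts 3 v) inc) ∧
      (inc.intScalar = 0 → inc.intVector = 0 → degreeIn 3 (toCounts 3 v) inc = 3) := by
  obtain ⟨s', a', δ', hs, ha, hδ⟩ := inc
  have hs' : (s' : ℚ) ≤ _ := Nat.cast_le.mpr hs
  have ha' : (a' : ℚ) ≤ _ := Nat.cast_le.mpr ha
  have ha0 : (0 : ℚ) ≤ a' := Nat.cast_nonneg _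
  have hs0 : (0 : ℚ) ≤ s' := Nat.cast_nonneg _
  cases v <;>
    simp only [VertexKind.isOfForm1315, toCounts, VertexKind.etaCount, VertexKind.scalarLegs, VertexKind.vectorLegs,
      VertexKind.diffCount, VertexKind.isAveragingVertex, degreeIn, Nat.cast_ofNat, Nat.cast_zero, Nat.cast_one,
      Bool.false_eq_true, if_false, if_true, nonpos_iff_eq_zero] at h1315 hs' ha' ha hδ ⊢ <;>
    subst hδ <;> push_cast at hs' ha' ⊢
  case v113 =>
    subst ha
    refine ⟨by simp; linarith, by simp, by simp, fun h0 _ => ?_⟩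
    subst h0; simp
  case v114 n n' =>
    refine ⟨by linarith, fun h1 => ?_, fun h2 => ?_, fun h0 h0' => ?_⟩
    · have : (1 : ℚ) ≤ a' := by exact_mod_cast h1
      linarith
    · have : (2 : ℚ) ≤ a' := by exact_mod_cast h2
      linarith
    · subst h0; subst h0'; simp
  case v115 n nb =>
    refine ⟨by linarith, fun h1 => ?_, fun h2 => ?_, fun h0 h0' => ?_⟩
    · have : (1 : ℚ) ≤ a' := by exact_mod_cast h1
      linarith
    · have : (2 : ℚ) ≤ a' := by exact_mod_cast h2
      linarith
    · subst h0; subst h0'; simp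

/-- d = 3: an admissible R-vertex (1.9)/(1.11) (Ã-exponent n̄ + 1) has D_G(v) ≥ n̄ + 1 in every graph (η-power d + n + n̄, resp.
d + n + n̄ − 1; p. 423 (iii)/(iv) with n′ = n̄ + 1) — the quantitative content of *"it is easy to notice that if a graph G has an
R-vertex of the form (1.9) and (1.11), then it has positive degree"* (p. 429). [cite: Balaban1983Higgs3, p.429] -/
theorem nbar_add_one_le_degreeIn {nbar : ℕ} (v : VertexKind) (hR : v.isRVertex = true) (h1315 : v.isOfForm1315 = false)
    (hv : v.Admissible nbar) (inc : Incidence (toCounts 3 v)) : (nbar : ℚ) + 1 ≤ degreeIn 3 (toCounts 3 v) inc := by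
  obtain ⟨s', a', δ', hs, ha, hδ⟩ := inc
  have hs' : (s' : ℚ) ≤ _ := Nat.cast_le.mpr hs
  have ha' : (a' : ℚ) ≤ _ := Nat.cast_le.mpr ha
  have hδ' : (δ' : ℚ) ≤ _ := Nat.cast_le.mpr hδ
  have ha0 : (0 : ℚ) ≤ a' := Nat.cast_nonneg _
  cases v <;>
    simp only [VertexKind.isRVertex, VertexKind.isOfForm1315, VertexKind.Admissible, toCounts, VertexKind.etaCount,
      VertexKind.scalarLegs, VertexKind.vectorLegs, VertexKind.diffCount, VertexKind.isAveragingVertex, degreeIn,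
      Nat.cast_ofNat, Nat.cast_zero, Nat.cast_one, Bool.false_eq_true, if_false, Bool.true_eq_false] at hR h1315 hv hs' ha' hδ' ⊢
  case v19 n nb =>
    obtain ⟨rfl, -⟩ := hv
    push_cast at hs' ha' hδ' ⊢
    have : (0 : ℚ) ≤ n := Nat.cast_nonneg _
    linarith
  case v111 n nb =>
    obtain ⟨rfl, -⟩ := hv
    push_cast at hs' ha' hδ' ⊢
    have : (0 : ℚ) ≤ n := Nat.cast_nonneg _
    linarith

/-- d = 3: a catalogue vertex with at least five external legs has D(v) ≥ 3/2 (it is (1.8)–(1.11) or (1.14)–(1.15) with n ≥ 3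
A′-legs; (1.6) has four legs, (1.7) two). [cite: Balaban1983Higgs3, p.423] -/
theorem three_halves_le_degree_of_ext (v : VertexKind) (inc : Incidence (toCounts 3 v))
    (h5 : 5 ≤ (v.scalarLegs - inc.intScalar) + (v.vectorLegs - inc.intVector)) : 3 / 2 ≤ degree 3 (toCounts 3 v) := by
  obtain ⟨s', a', δ', hs, ha, hδ⟩ := inc
  cases v <;>
    simp only [VertexKind.scalarLegs, VertexKind.vectorLegs, toCounts_v16, toCounts_v17,
      toCounts_v18, toCounts_v19, toCounts_v110, toCounts_v111, degree_toCounts_v113, toCounts_v114, toCounts_v115,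
      degree_v16, degree_v17, degree_v18, degree_v110, degree_v1315] at h5 ⊢ <;> push_cast
  case v16 => omega
  case v17 => omega
  case v18 n n' =>
    have : (3 : ℚ) ≤ n := by exact_mod_cast (show 3 ≤ n by omega)
    have : (0 : ℚ) ≤ n' := Nat.cast_nonneg _
    linarith
  case v19 n nb =>
    have : (3 : ℚ) ≤ n := by exact_mod_cast (show 3 ≤ n by omega)
    have : (0 : ℚ) ≤ nb := Nat.cast_nonneg _
    linarith
  case v110 n n' =>
    have : (3 : ℚ) ≤ n := by exact_mod_cast (show 3 ≤ n by omega)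
    have : (0 : ℚ) ≤ n' := Nat.cast_nonneg _
    linarith
  case v111 n nb =>
    have : (3 : ℚ) ≤ n := by exact_mod_cast (show 3 ≤ n by omega)
    have : (0 : ℚ) ≤ nb := Nat.cast_nonneg _
    linarith
  case v113 => norm_num
  case v114 n n' =>
    have : (0 : ℚ) ≤ n := Nat.cast_nonneg _
    linarith
  case v115 n nb =>
    have : (0 : ℚ) ≤ n := Nat.cast_nonneg _
    linarith

end Facts

end Literature.MathematicalPhysics.QuantumFieldTheory.Balaban1983to89.B3Cor23Concrete
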